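import Literature.NumberTheory.Automorphic.HyperspecialUnitaryRankOneHeckeNeighbours   -- ★ p833008 (L1): `torusGen`, `heisMid`, `bijOn_heckeNeighbours`, exhaustion
import Literature.NumberTheory.Automorphic.ContractingTransversalDistanceRegular     -- ★ p832624 (L2-gen): `not_isSquareIntegrableModCenter_of_isSpherical_of_contracting`
import Literature.NumberTheory.Automorphic.HyperspecialUnitaryCompactOpen               -- ★ `isOpen_unitaryInt`, `isCompact_unitaryInt_of_forall_v_eq`
import Literature.NumberTheory.Automorphic.LocalUnitaryGroupCenter                     -- ★ `exists_coe_eq_scalar_of_mem_center_unitaryGroupOfForm`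
import HarnessLib

/-!
# No `K₀`-spherical smooth representation of the unramified `U(3)` is square-integrable modulo the centre — the hyperspecial vertex of the
# semi-homogeneous tree carries no `L²` spherical function (Macdonald 1971 Ch. V; Cartier 1979 §IV.1; Bruhat–Tits 1972 (4.4.4))

Topic `NumberTheory/Automorphic`; namespace `Literature.NumberTheory.Automorphic.HermitianLattice.UnramifiedLocalConjDatum`.  THEOREMS ONLY: no
definition, no named fact, no instance, no notation, no `sorry`.  Cell `hodgecm-mathlib`, F0∕P3, fan-B row #90 (SqNS) ∕ #79 (XP), road (B) «local»,
brick **(L1b)** (F0P3-plan (g7) «=» 2026-08-31T19:48:39Z): the COUNTS and the JUNCTION.  With ★ (L1) `HyperspecialUnitaryRankOneHeckeNeighbours`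
(the contracting transversal `R₊ t ∪ u(0, R₀) ∪ {t⁻¹}` of `K₀ t K₀ ∕ K₀` for ANY transversals `R₊`, `R₀`), this file
* §1 PICKS `R₊ ⊆ K_P`, a transversal of `K_P ∕ t K_P t⁻¹` with `#R₊ = [K_P : tK_Pt⁻¹] = q²` (`q = #𝓀[K]`; ★ `relIndex_conjAct_borelInt_eq_pow_three`,
  Mathlib `Subgroup.exists_isComplement_left`);
* §2 PICKS `R₀ ⊆ K⁰ = ker(id + σ)`, a transversal of the valuation-`v(ϖ⁻¹)` classes modulo `𝒪⁰`, `#R₀ = [L_1 : L_0] - 1 = √q - 1`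
  (★ `UnramifiedTraceZeroLatticeIndex.relIndex_leAddSubgroup_inf_ker_add_exp`, `√q·√q = q` ★ `sqrt_card_residueField_mul_self`);
* §3 `center_le_unitaryInt`: `Z(U(σ,J₀)(K)) ≤ K₀` (central elements are norm-one scalars, ★ `exists_coe_eq_scalar_of_mem_center_unitaryGroupOfForm`);
* §4 **`not_isSquareIntegrableModCenter_of_isSpherical_unitary_three`** — for `hd : UnramifiedLocalConjDatum σ ϖ` with `σ ≠ id`, finite residue
  field and compact valuation ring (`K₀` compact open, ★ `HyperspecialUnitaryCompactOpen`), `2, 3 ≠ 0` in `K`: NO smooth `K₀`-spherical representation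
  of `U(σ, J₀)(K)` (`N = 3`) is square-integrable modulo the centre, for any Haar measure on `G ⧸ Z(G)` — ★ (L2-gen) at `(a, b) = ((√q)³, √q)`
  (`ab = q²`, `b ≤ a`: the hyperspecial vertex of the `(q_w^{3/2}+1, q_w^{1/2}+1)`-tree, `q = q_w = q_v²`) [Macdonald1971 Ch. V §3; CartierCorvallis1979 §IV.1];
* §5 **`exists_contractingTransversal_unitary_three`** — the same datum PACKAGED without topology or representations (the binder list of ★
  `…of_contracting` ∕ ★ `…of_contracting_comap` p832978), for the CM transport ★ `Theorems/F0P3SqIntNotSphericalOfHeckeNeighbours` (B-p08 (g23)).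
Honesty: for the OTHER special (non-hyperspecial) vertex `(a, b)` swap and an `L²` spherical function exists — Rogawski's square-integrable `π²(ξ_v)`
has a vector under that subgroup [Rogawski1990 §12.2 (2)]; hyperspeciality of `K₀ = U ∩ GL₃(𝒪)` enters exactly through `b ≤ a`.
HC_CM is proved only modulo the printed citations until rung 0 closes; this file is unconditional and discharges nothing by itself.

## References
* [Macdonald1971] I. G. Macdonald, *Spherical functions on a group of p-adic type* (1971), Ch. V §3.
* [CartierCorvallis1979] P. Cartier, *Representations of 𝔭-adic groups: a survey*, PSPM 33.1 (1979), §IV.1, §IV (4.2).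
* [BruhatTits1972] F. Bruhat, J. Tits, *Groupes réductifs sur un corps local I*, Publ. Math. IHÉS 41 (1972), (4.4.3), (4.4.4).
* [SerreTrees1980] J.-P. Serre, *Trees* (1980), II.1.1.
* [Serre1979] J.-P. Serre, *Local Fields*, GTM 67 (1979), Ch. I §1, Ch. V §2.
* [Rogawski1990] J. D. Rogawski, *Automorphic Representations of Unitary Groups in Three Variables*, Ann. of Math. Stud. 123 (1990), §1.10 p. 14, §12.2 (2) pp. 173–174.
* [PlatonovRapinchuk1994] V. Platonov, A. Rapinchuk, *Algebraic Groups and Number Theory* (1994), §2.3.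
* [Tits1979] J. Tits, *Reductive groups over local fields*, PSPM 33.1 (1979), §3.2, §3.3.3.
-/

set_option autoImplicit false

noncomputable section

open scoped Valued WithZero Matrix MatrixGroups Pointwise
open MulAction ConjAct
namespace Literature.NumberTheory.Automorphic.HermitianLattice

open Literature.NumberTheory.Automorphic.CartanUnique Literature.NumberTheory.Automorphic.SymplecticCartan
open Literature.NumberTheory.Automorphic.SphericalCoefficient

variable {K : Type*} [Field K] [Valued K ℤᵐ⁰] {σ : K →+* K} {ϖ : K}

namespace UnramifiedLocalConjDatum

/-! ## §1 A transversal of `K_P ∕ t K_P t⁻¹` with `q²` elements -/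

/-- **A transversal `R₊ ⊆ K_P` of `K_P ∕ t K_P t⁻¹` with `#R₊ = q²`** (`q = #𝓀[K]`; ★ `relIndex_conjAct_borelInt_eq_pow_three` at `(1,0,-1)` and
Mathlib's `Subgroup.exists_isComplement_left`). [cite: BruhatTits1972, (4.4.4)] [cite: CartierCorvallis1979, §IV (4.2)] -/
theorem exists_transversal_borelInt (hd : UnramifiedLocalConjDatum σ ϖ) (hσ : ∃ x : K, σ x ≠ x) [Finite 𝓀[K]] :
    ∃ Rp : Finset (unitaryGroupOfForm σ ((StdForm.antidiagonal 3).over K)),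
      (∀ u ∈ Rp, u ∈ hd.borelLatticeU ⊓ unitaryInt σ ((StdForm.antidiagonal 3).over K)) ∧
      (∀ u ∈ Rp, ∀ u' ∈ Rp, u⁻¹ * u' ∈ toConjAct hd.torusGen • (hd.borelLatticeU ⊓ unitaryInt σ ((StdForm.antidiagonal 3).over K)) → u = u') ∧
      (∀ u ∈ hd.borelLatticeU ⊓ unitaryInt σ ((StdForm.antidiagonal 3).over K),
        ∃ r ∈ Rp, r⁻¹ * u ∈ toConjAct hd.torusGen • (hd.borelLatticeU ⊓ unitaryInt σ ((StdForm.antidiagonal 3).over K))) ∧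
      Rp.card = Nat.card 𝓀[K] ^ 2 := by
  classical
  set KP := hd.borelLatticeU ⊓ unitaryInt σ ((StdForm.antidiagonal 3).over K) with hKP
  set A := toConjAct hd.torusGen • KP with hA
  set H' : Subgroup KP := A.subgroupOf KP with hH'
  obtain ⟨S, hS, -⟩ := H'.exists_isComplement_left 1
  have hidx : H'.index = Nat.card 𝓀[K] ^ 2 := by
    change A.relIndex KP = _
    have h := hd.relIndex_conjAct_borelInt_eq_pow_three hσ rev_cocharOne
    rw [show (2 * (![1, 0, -1] : Fin 3 → ℤ) 0).toNat = 2 by rfl] at h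
    exact h
  have hcardS : Nat.card S = Nat.card 𝓀[K] ^ 2 := hS.card_left.trans hidx
  haveI : Nonempty 𝓀[K] := ⟨0⟩
  have hq0 : Nat.card 𝓀[K] ≠ 0 := Nat.card_pos.ne'
  have hSfin : S.Finite := Nat.finite_of_card_ne_zero (by rw [hcardS]; exact pow_ne_zero 2 hq0)
  have huniq := Subgroup.isComplement_iff_existsUnique_inv_mul_mem.1 hS
  refine ⟨hSfin.toFinset.image (fun s : KP => (s : unitaryGroupOfForm σ ((StdForm.antidiagonal 3).over K))), ?_, ?_, ?_, ?_⟩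
  · intro u hu
    obtain ⟨s, -, rfl⟩ := Finset.mem_image.1 hu
    exact s.2
  · intro u hu u' hu' huu'
    obtain ⟨s, hs, rfl⟩ := Finset.mem_image.1 hu
    obtain ⟨s', hs', rfl⟩ := Finset.mem_image.1 hu'
    rw [Set.Finite.mem_toFinset] at hs hs'
    obtain ⟨x, -, hx⟩ := huniq s'
    have h1 : (⟨s, hs⟩ : S) = x := hx ⟨s, hs⟩ (by
      change (s : KP)⁻¹ * s' ∈ H'
      rw [Subgroup.mem_subgroupOf]; simpa using huu')
    have h2 : (⟨s', hs'⟩ : S) = x := hx ⟨s', hs'⟩ (by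
      change (s' : KP)⁻¹ * s' ∈ H'
      rw [inv_mul_cancel]; exact H'.one_mem)
    have h3 := h1.trans h2.symm
    rw [Subtype.mk.injEq] at h3
    rw [h3]
  · intro u hu
    obtain ⟨x, hx, -⟩ := huniq ⟨u, hu⟩
    refine ⟨((x : KP) : unitaryGroupOfForm σ ((StdForm.antidiagonal 3).over K)),
      Finset.mem_image.2 ⟨(x : KP), by rw [Set.Finite.mem_toFinset]; exact x.2, rfl⟩, ?_⟩
    rw [SetLike.mem_coe, Subgroup.mem_subgroupOf] at hx
    simpa using hx
  · rw [Finset.card_image_of_injective _ Subtype.val_injective, ← Set.ncard_eq_toFinset_card S hSfin, ← Nat.card_coe_set_eq, hcardS]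

/-! ## §2 A transversal of the valuation-`v(ϖ⁻¹)` classes of `K⁰ = ker(id + σ)` modulo `𝒪⁰`, with `√q - 1` elements -/

/-- **A transversal `R₀` of `(ϖ⁻¹𝒪⁰ ∖ 𝒪⁰) ∕ 𝒪⁰` with `#R₀ = √q - 1`** (`√q · √q = q`; ★ `relIndex_leAddSubgroup_inf_ker_add_exp` `[L_1 : L_0] = √q` and
`AddSubgroup.exists_isComplement_left` through `0`). [cite: Serre1979, Ch. V §2] [cite: BruhatTits1972, (4.4.4)] -/
theorem exists_transversal_traceZero (hd : UnramifiedLocalConjDatum σ ϖ) (hσ : ∃ x : K, σ x ≠ x) [Finite 𝓀[K]] :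
    ∃ R0 : Finset (AddMonoidHom.id K + σ.toAddMonoidHom).ker,
      (∀ y ∈ R0, Valued.v (y : K) = WithZero.exp (1 : ℤ)) ∧
      (∀ y ∈ R0, ∀ y' ∈ R0, Valued.v ((y' : K) - y) ≤ 1 → y = y') ∧
      (∀ y : (AddMonoidHom.id K + σ.toAddMonoidHom).ker, Valued.v (y : K) = WithZero.exp (1 : ℤ) → ∃ r ∈ R0, Valued.v ((y : K) - r) ≤ 1) ∧
      R0.card = Nat.sqrt (Nat.card 𝓀[K]) - 1 := by
  classical
  set L1 := (Valued.v : Valuation K ℤᵐ⁰).leAddSubgroup (WithZero.exp (1 : ℤ)) ⊓ (AddMonoidHom.id K + σ.toAddMonoidHom).ker with hL1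
  set L0 := (Valued.v : Valuation K ℤᵐ⁰).leAddSubgroup (WithZero.exp (0 : ℤ)) ⊓ (AddMonoidHom.id K + σ.toAddMonoidHom).ker with hL0
  set H' : AddSubgroup L1 := L0.addSubgroupOf L1 with hH'
  obtain ⟨S, hS, h0S⟩ := H'.exists_isComplement_left 0
  have hidx : H'.index = Nat.sqrt (Nat.card 𝓀[K]) := by
    change L0.relIndex L1 = _
    have h := hd.relIndex_leAddSubgroup_inf_ker_add_exp hσ 1 0
    rw [show ((1 : ℤ) - 0).toNat = 1 by rfl, pow_one] at h
    exact h
  have hcardS : Nat.card S = Nat.sqrt (Nat.card 𝓀[K]) := hS.card_left.trans hidx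
  have hsq := hd.sqrt_card_residueField_mul_self hσ
  haveI : Nonempty 𝓀[K] := ⟨0⟩
  have hq0 : Nat.card 𝓀[K] ≠ 0 := Nat.card_pos.ne'
  have hs0 : Nat.sqrt (Nat.card 𝓀[K]) ≠ 0 := fun h => hq0 (by rw [← hsq, h, mul_zero])
  have hSfin : S.Finite := Nat.finite_of_card_ne_zero (by rw [hcardS]; exact hs0)
  have huniq := AddSubgroup.isComplement_iff_existsUnique_neg_add_mem.1 hS
  -- membership in `H'` is `v ≤ 1`
  have hmemH : ∀ s : L1, s ∈ H' ↔ Valued.v ((s : L1) : K) ≤ 1 := by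
    intro s
    rw [hH', AddSubgroup.mem_addSubgroupOf, hL0, AddSubgroup.mem_inf, Valuation.mem_leAddSubgroup_iff, WithZero.exp_zero]
    exact ⟨fun h => h.1, fun h => ⟨h, (AddSubgroup.mem_inf.1 s.2).2⟩⟩
  -- the only element of `S` inside `L_0` is `0`
  have hS0 : ∀ s ∈ S, Valued.v ((s : L1) : K) ≤ 1 → s = 0 := by
    intro s hs hv
    obtain ⟨x, -, hx⟩ := huniq 0
    have h1 : (⟨s, hs⟩ : S) = x := hx ⟨s, hs⟩ (by
      change -s + 0 ∈ H'
      rw [add_zero]; exact H'.neg_mem ((hmemH s).2 hv))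
    have h2 : (⟨0, h0S⟩ : S) = x := hx ⟨0, h0S⟩ (by
      change -(0 : L1) + 0 ∈ H'
      rw [neg_zero, add_zero]; exact H'.zero_mem)
    have h3 := h1.trans h2.symm
    rwa [Subtype.mk.injEq] at h3
  let emb : L1 → (AddMonoidHom.id K + σ.toAddMonoidHom).ker := fun s => ⟨(s : K), (AddSubgroup.mem_inf.1 s.2).2⟩
  have hemb : Function.Injective emb := fun a b h => Subtype.ext (congrArg Subtype.val h : ((emb a : _) : K) = emb b)
  refine ⟨(hSfin.toFinset.filter fun s => ¬ Valued.v ((s : L1) : K) ≤ 1).image emb, ?_, ?_, ?_, ?_⟩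
  · intro y hy
    obtain ⟨s, hs, rfl⟩ := Finset.mem_image.1 hy
    rw [Finset.mem_filter] at hs
    exact v_eq_exp_one_of_one_lt (lt_of_not_ge hs.2) ((AddSubgroup.mem_inf.1 s.2).1)
  · intro y hy y' hy' hv
    obtain ⟨s, hs, rfl⟩ := Finset.mem_image.1 hy
    obtain ⟨s', hs', rfl⟩ := Finset.mem_image.1 hy'
    rw [Finset.mem_filter, Set.Finite.mem_toFinset] at hs hs'
    obtain ⟨x, -, hx⟩ := huniq s'
    have h1 : (⟨s, hs.1⟩ : S) = x := hx ⟨s, hs.1⟩ (by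
      change -s + s' ∈ H'
      refine (hmemH _).2 ?_
      rw [AddSubgroup.coe_add, AddSubgroup.coe_neg, neg_add_eq_sub]; exact hv)
    have h2 : (⟨s', hs'.1⟩ : S) = x := hx ⟨s', hs'.1⟩ (by
      change -s' + s' ∈ H'
      rw [neg_add_cancel]; exact H'.zero_mem)
    have h3 := h1.trans h2.symm
    rw [Subtype.mk.injEq] at h3
    rw [h3]
  · intro y hy
    have hyL1 : (y : K) ∈ L1 := AddSubgroup.mem_inf.2 ⟨Valuation.mem_leAddSubgroup_iff.2 hy.le, y.2⟩
    obtain ⟨x, hx, -⟩ := huniq ⟨y, hyL1⟩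
    have hxv : Valued.v ((y : K) - ((x : L1) : K)) ≤ 1 := by
      have h := (hmemH _).1 (by rw [SetLike.mem_coe] at hx; exact hx)
      rwa [AddSubgroup.coe_add, AddSubgroup.coe_neg, neg_add_eq_sub] at h
    have hxn : ¬ Valued.v (((x : L1) : L1) : K) ≤ 1 := by
      intro hle
      have h : Valued.v (y : K) ≤ 1 := by
        have e : (y : K) = ((x : L1) : K) + ((y : K) - ((x : L1) : K)) := by ring
        rw [e]; exact (Valuation.map_add _ _ _).trans (max_le hle hxv)
      rw [hy, ← WithZero.exp_zero, WithZero.exp_le_exp] at h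
      norm_num at h
    exact ⟨emb x, Finset.mem_image.2 ⟨x, Finset.mem_filter.2 ⟨by rw [Set.Finite.mem_toFinset]; exact x.2, hxn⟩, rfl⟩, hxv⟩
  · rw [Finset.card_image_of_injective _ hemb]
    have hsplit := Finset.card_filter_add_card_filter_not (s := hSfin.toFinset) (fun s : L1 => Valued.v ((s : L1) : K) ≤ 1)
    have hone : (hSfin.toFinset.filter fun s : L1 => Valued.v ((s : L1) : K) ≤ 1) = {(0 : L1)} := by
      ext s
      simp only [Finset.mem_filter, Set.Finite.mem_toFinset, Finset.mem_singleton]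
      constructor
      · exact fun h => hS0 s h.1 h.2
      · rintro rfl; exact ⟨h0S, by rw [ZeroMemClass.coe_zero, map_zero]; exact zero_le⟩
    rw [hone, Finset.card_singleton, ← Set.ncard_eq_toFinset_card S hSfin, ← Nat.card_coe_set_eq, hcardS] at hsplit
    omega

/-! ## §3 The centre of `U(3)(K)` lies in `K₀` -/

/-- **`Z(U(σ, J₀)(K)) ≤ K₀`**: a central element is a scalar `u · 1` (★ `exists_coe_eq_scalar_of_mem_center_unitaryGroupOfForm`, `2, 3 ≠ 0` in `K`)
with `σ(u) u = 1`, so `v(u) = 1` and `u · 1` is integral. [cite: PlatonovRapinchuk1994, §2.3] [cite: Tits1979, §3.3.3] -/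
theorem center_le_unitaryInt (hd : UnramifiedLocalConjDatum σ ϖ) (h2 : (2 : K) ≠ 0) (h3 : (3 : K) ≠ 0) :
    Subgroup.center (unitaryGroupOfForm σ ((StdForm.antidiagonal 3).over K)) ≤ unitaryInt σ ((StdForm.antidiagonal 3).over K) := by
  intro z hz
  have hH : (((StdForm.antidiagonal 3).over K).map σ)ᵀ = (StdForm.antidiagonal 3).over K := by
    rw [StdForm.over_map, StdForm.transpose_over]
  have hHd : ((StdForm.antidiagonal 3).over K).det ≠ 0 :=
    ((Matrix.isUnit_iff_isUnit_det _).1 ((StdForm.antidiagonal 3).isUnit_over K)).ne_zero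
  obtain ⟨u, hu⟩ := UnitaryGroup.exists_coe_eq_scalar_of_mem_center_unitaryGroupOfForm σ ((StdForm.antidiagonal 3).over K) hd.σσ hH hHd h2 h3 hz
  -- `σ(u) u = 1` from the `(0, 2)` unitarity relation
  have hrel := sum_map_mul_rev_apply_eq z 0 2
  rw [Fin.sum_univ_three, show Fin.rev (0 : Fin 3) = 2 from by decide, show Fin.rev (1 : Fin 3) = 1 from by decide,
    show Fin.rev (2 : Fin 3) = 0 from by decide, if_pos rfl, hu] at hrel
  simp only [Matrix.GeneralLinearGroup.coe_scalar, Matrix.scalar_apply, Matrix.diagonal_apply_eq, Matrix.diagonal_apply_ne _ (by decide : (2 : Fin 3) ≠ 0),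
    Matrix.diagonal_apply_ne _ (by decide : (1 : Fin 3) ≠ 0), Matrix.diagonal_apply_ne _ (by decide : (1 : Fin 3) ≠ 2),
    Matrix.diagonal_apply_ne _ (by decide : (0 : Fin 3) ≠ 2), map_zero, mul_zero, add_zero] at hrel
  have hvu : Valued.v (u : K) = 1 := by
    have h := congrArg Valued.v hrel
    rw [map_mul, hd.vσ, map_one] at h
    rcases le_or_gt (Valued.v (u : K)) 1 with hle | hgt
    · rcases hle.lt_or_eq with hlt | heq
      · exfalso
        have : Valued.v (u : K) * Valued.v (u : K) < 1 := by
          calc Valued.v (u : K) * Valued.v (u : K) ≤ Valued.v (u : K) * 1 := mul_le_mul_right hle _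
            _ = Valued.v (u : K) := mul_one _
            _ < 1 := hlt
        exact this.ne h
      · exact heq
    · exfalso
      have : 1 < Valued.v (u : K) * Valued.v (u : K) := by
        calc (1 : ℤᵐ⁰) < Valued.v (u : K) := hgt
          _ = Valued.v (u : K) * 1 := (mul_one _).symm
          _ ≤ Valued.v (u : K) * Valued.v (u : K) := mul_le_mul_right hgt.le _
      exact this.ne' h
  rw [mem_unitaryInt_iff_forall_v_le_one hd.vσ]
  intro i j
  rw [hu, Matrix.GeneralLinearGroup.coe_scalar, Matrix.scalar_apply, Matrix.diagonal_apply]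
  split_ifs
  · exact hvu.le
  · rw [map_zero]; exact zero_le

/-! ## §4 No `K₀`-spherical smooth representation of `U(3)(K)` is square-integrable modulo the centre -/

omit [Valued K ℤᵐ⁰] in
/-- `y ↦ u(0, y)` is injective (read off the `(0, 2)` entry). [cite: Rogawski1990, §1.10 p. 14] -/
theorem heisMid_injective (σ : K →+* K) : Function.Injective (heisMid σ) := by
  intro y y' h
  have h' := congrArg (fun g : unitaryGroupOfForm σ ((StdForm.antidiagonal 3).over K) => ((g : GL (Fin 3) K) : Matrix (Fin 3) (Fin 3) K) 0 2) h
  simp only [coe_heisMid, transvection_zero_two_apply, Fin.isValue, show (0 : Fin 3) = 2 ↔ False by decide, if_false, and_self,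
    if_true, zero_add] at h'
  exact Subtype.ext h'

/-- **MACDONALD–CASSELMAN FOR THE UNRAMIFIED `U(3)`, HYPERSPECIAL LEVEL, WITHOUT THE SPHERICAL FUNCTION: no smooth `K₀`-spherical representation
of `U(σ, J₀)(K)` (`N = 3`) is square-integrable modulo the centre.**  Hypotheses: `hd : UnramifiedLocalConjDatum σ ϖ` with `σ ≠ id`, finite residue
field, compact valuation ring (so `K₀` is compact open, ★ `isCompact_unitaryInt_of_forall_v_eq` ∕ `isOpen_unitaryInt`), `2, 3 ≠ 0` in `K` (centre =
norm-one scalars ≤ `K₀`, §3).  Proof: ★ `SphericalCoefficient.not_isSquareIntegrableModCenter_of_isSpherical_of_contracting` (L2-gen) at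
`(G, K, K_N, t) = (U(σ,J₀)(K), K₀, K_P, diag(ϖ,1,ϖ⁻¹))` with the contracting transversal of ★ `bijOn_heckeNeighbours` (L1) on the transversals of §1–§2:
`|X₊| = [K_P : tK_Pt⁻¹] = q² = (√q)³·√q`, `|X₀| = [L_1 : L_0] - 1 = √q - 1`, i.e. `(a, b) = ((√q)³, √q)`, `b ≤ a`, `ab = q² ≥ 4` — the radius-one
Hecke recurrence of the `(q³+1, q+1)`-tree (`q` here `= q_F = √(#𝓀[K])`) has no `ℓ²` solution at the hyperspecial vertex [Macdonald1971 Ch. V].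
For the OTHER special vertex the roles of `a, b` swap and an `L²` spherical function exists (the square-integrable `π²(ξ)` of [Rogawski1990 §12.2]);
hyperspeciality enters exactly through `b ≤ a`.
[cite: Macdonald1971, Ch. V §3] [cite: CartierCorvallis1979, §IV.1] [cite: BruhatTits1972, (4.4.4)] [cite: Rogawski1990, §12.2 (2) pp. 173–174] -/
theorem not_isSquareIntegrableModCenter_of_isSpherical_unitary_three (hd : UnramifiedLocalConjDatum σ ϖ) (hσ : ∃ x : K, σ x ≠ x)
    [Finite 𝓀[K]] [CompactSpace 𝒪[K]] (h2 : (2 : K) ≠ 0) (h3 : (3 : K) ≠ 0)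
    [MeasurableSpace (unitaryGroupOfForm σ ((StdForm.antidiagonal 3).over K) ⧸ Subgroup.center (unitaryGroupOfForm σ ((StdForm.antidiagonal 3).over K)))]
    [BorelSpace (unitaryGroupOfForm σ ((StdForm.antidiagonal 3).over K) ⧸ Subgroup.center (unitaryGroupOfForm σ ((StdForm.antidiagonal 3).over K)))]
    {V : Type*} [AddCommGroup V] [Module ℂ V] {ρ : Representation ℂ (unitaryGroupOfForm σ ((StdForm.antidiagonal 3).over K)) V}
    (hρ : ρ.IsSmooth) (h1 : ρ.IsSpherical (unitaryInt σ ((StdForm.antidiagonal 3).over K)))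
    (μ : MeasureTheory.Measure (unitaryGroupOfForm σ ((StdForm.antidiagonal 3).over K) ⧸ Subgroup.center (unitaryGroupOfForm σ ((StdForm.antidiagonal 3).over K))))
    [μ.IsHaarMeasure] : ¬ ρ.IsSquareIntegrableModCenter μ := by
  classical
  obtain ⟨Rp, hRp, hRp_inj, hRp_surj, hcardp⟩ := hd.exists_transversal_borelInt hσ
  obtain ⟨R0, hR0, hR0_inj, hR0_surj, hcard0⟩ := hd.exists_transversal_traceZero hσ
  have hsq := hd.sqrt_card_residueField_mul_self hσ
  set s := Nat.sqrt (Nat.card 𝓀[K]) with hs_def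
  haveI : Nontrivial 𝓀[K] := inferInstance
  have hq2 : 2 ≤ Nat.card 𝓀[K] := Finite.one_lt_card
  have hs0 : s ≠ 0 := fun h => by rw [← hsq, h, mul_zero] at hq2; omega
  have hba : s ≤ s ^ 3 := Nat.le_self_pow (by norm_num) _
  have hab : 2 ≤ s ^ 3 * s := by
    have h : s ^ 3 * s = Nat.card 𝓀[K] * Nat.card 𝓀[K] := by rw [← hsq]; ring
    rw [h]; nlinarith
  refine not_isSquareIntegrableModCenter_of_isSpherical_of_contracting (KN := hd.borelLatticeU ⊓ unitaryInt σ ((StdForm.antidiagonal 3).over K))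
    (t := hd.torusGen) (Xp := Rp.image (· * hd.torusGen)) (X0 := R0.image (heisMid σ)) hba hab
    (isOpen_unitaryInt σ _) (isCompact_unitaryInt_of_forall_v_eq hd.vσ _) (hd.center_le_unitaryInt h2 h3) inf_le_right
    (fun u hu => hd.conj_torusGen_mem_borelInt hu) hd.inv_torusGen_mem_doubleCoset (fun m n hmn => hd.disjoint_doubleCoset_torusGen_pow hmn)
    (fun x hx => ?_) (fun x hx => ?_) (hd.bijOn_heckeNeighbours hRp hRp_inj hRp_surj hR0 hR0_inj hR0_surj) ?_ ?_ hρ h1 μ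
  · obtain ⟨u, hu, rfl⟩ := Finset.mem_image.1 hx
    rw [mul_inv_cancel_right]; exact hRp u hu
  · obtain ⟨y, hy, rfl⟩ := Finset.mem_image.1 hx
    exact hd.conj_torusGen_heisMid_mem_borelInt (by rw [hR0 y hy, WithZero.exp_le_exp]; norm_num)
  · rw [Finset.card_image_of_injective _ (mul_left_injective hd.torusGen), hcardp, ← hsq]; ring
  · rw [Finset.card_image_of_injective _ (heisMid_injective σ), hcard0]

/-! ## §5 EXPORT: the contracting-transversal datum of `(U(3)(K), K₀)` for the CM transport (★ `F0P3SqIntNotSphericalOfHeckeNeighbours`) -/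

/-- **THE HECKE-NEIGHBOUR DATUM OF THE UNRAMIFIED `U(3)`, PACKAGED** — for `hd : UnramifiedLocalConjDatum σ ϖ` with `σ ≠ id` and finite residue field:
there are `K_N ≤ K₀`, `a ≥ b` with `ab ≥ 2`, `t` contracting `K_N` and symmetric with pairwise disjoint shells, and finite `X₊, X₀` in contracting position
with `|X₊| = ab`, `|X₀| = b - 1` and `X₊ ∪ X₀ ∪ {t⁻¹}` a transversal of `K₀ t K₀ ∕ K₀` — LITERALLY the binder list of ★
`SphericalCoefficient.not_isSquareIntegrableModCenter_of_isSpherical_of_contracting` ∕ `…_comap` minus the topological and representation-theoretic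
binders (witnesses: `K_N = K_P`, `(a, b) = (√q³, √q)`, `t = diag(ϖ,1,ϖ⁻¹)`, `X₊ = R₊ t`, `X₀ = u(0, R₀)`; the `DecidableEq` instance is the caller's).
[cite: BruhatTits1972, (4.4.4)] [cite: Macdonald1971, Ch. V §3] [cite: SerreTrees1980, II.1.1] -/
theorem exists_contractingTransversal_unitary_three
    [DecidableEq (unitaryGroupOfForm σ ((StdForm.antidiagonal 3).over K))]
    (hd : UnramifiedLocalConjDatum σ ϖ) (hσ : ∃ x : K, σ x ≠ x) [Finite 𝓀[K]] :
    ∃ (KN : Subgroup (unitaryGroupOfForm σ ((StdForm.antidiagonal 3).over K))) (a b : ℕ)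
      (t : unitaryGroupOfForm σ ((StdForm.antidiagonal 3).over K)) (Xp X0 : Finset (unitaryGroupOfForm σ ((StdForm.antidiagonal 3).over K))),
      b ≤ a ∧ 2 ≤ a * b ∧ KN ≤ unitaryInt σ ((StdForm.antidiagonal 3).over K) ∧ (∀ u ∈ KN, t * u * t⁻¹ ∈ KN) ∧
      t⁻¹ ∈ DoubleCoset.doubleCoset t (unitaryInt σ ((StdForm.antidiagonal 3).over K) : Set _) (unitaryInt σ ((StdForm.antidiagonal 3).over K)) ∧
      (∀ m n : ℕ, m ≠ n → Disjoint
        (DoubleCoset.doubleCoset (t ^ m) (unitaryInt σ ((StdForm.antidiagonal 3).over K) : Set _) (unitaryInt σ ((StdForm.antidiagonal 3).over K)))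
        (DoubleCoset.doubleCoset (t ^ n) (unitaryInt σ ((StdForm.antidiagonal 3).over K) : Set _) (unitaryInt σ ((StdForm.antidiagonal 3).over K)))) ∧
      (∀ x ∈ Xp, x * t⁻¹ ∈ KN) ∧ (∀ x ∈ X0, t * x * t⁻¹ ∈ KN) ∧
      Set.BijOn (fun x : unitaryGroupOfForm σ ((StdForm.antidiagonal 3).over K) =>
          (x : unitaryGroupOfForm σ ((StdForm.antidiagonal 3).over K) ⧸ unitaryInt σ ((StdForm.antidiagonal 3).over K)))
        (Xp ∪ X0 ∪ {t⁻¹} : Finset _)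
        (orbit (unitaryInt σ ((StdForm.antidiagonal 3).over K))
          (t : unitaryGroupOfForm σ ((StdForm.antidiagonal 3).over K) ⧸ unitaryInt σ ((StdForm.antidiagonal 3).over K))) ∧
      Xp.card = a * b ∧ X0.card = b - 1 := by
  classical
  obtain ⟨Rp, hRp, hRp_inj, hRp_surj, hcardp⟩ := hd.exists_transversal_borelInt hσ
  obtain ⟨R0, hR0, hR0_inj, hR0_surj, hcard0⟩ := hd.exists_transversal_traceZero hσ
  have hsq := hd.sqrt_card_residueField_mul_self hσ
  set s := Nat.sqrt (Nat.card 𝓀[K]) with hs_def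
  haveI : Nontrivial 𝓀[K] := inferInstance
  have hq2 : 2 ≤ Nat.card 𝓀[K] := Finite.one_lt_card
  have hba : s ≤ s ^ 3 := Nat.le_self_pow (by norm_num) _
  have hab : 2 ≤ s ^ 3 * s := by
    have h : s ^ 3 * s = Nat.card 𝓀[K] * Nat.card 𝓀[K] := by rw [← hsq]; ring
    rw [h]; nlinarith
  have hX := hd.bijOn_heckeNeighbours hRp hRp_inj hRp_surj hR0 hR0_inj hR0_surj
  refine ⟨hd.borelLatticeU ⊓ unitaryInt σ ((StdForm.antidiagonal 3).over K), s ^ 3, s, hd.torusGen, Rp.image (· * hd.torusGen), R0.image (heisMid σ),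
    hba, hab, inf_le_right, fun u hu => hd.conj_torusGen_mem_borelInt hu, hd.inv_torusGen_mem_doubleCoset,
    fun m n hmn => hd.disjoint_doubleCoset_torusGen_pow hmn, fun x hx => ?_, fun x hx => ?_, ?_, ?_, ?_⟩
  · obtain ⟨u, hu, rfl⟩ := Finset.mem_image.1 hx
    rw [mul_inv_cancel_right]; exact hRp u hu
  · obtain ⟨y, hy, rfl⟩ := Finset.mem_image.1 hx
    exact hd.conj_torusGen_heisMid_mem_borelInt (by rw [hR0 y hy, WithZero.exp_le_exp]; norm_num)
  · simp only [Finset.coe_union, Finset.coe_singleton, Finset.coe_image] at hX ⊢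
    exact hX
  · rw [Finset.card_image_of_injective _ (mul_left_injective hd.torusGen), hcardp, ← hsq]; ring
  · rw [Finset.card_image_of_injective _ (heisMid_injective σ), hcard0]

end UnramifiedLocalConjDatum

end Literature.NumberTheory.Automorphic.HermitianLattice

end
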